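import Summits.ValiantsHypothesis.ValiantsHypothesis.Theorems.SymPencilAffineKernelLever
import Summits.ValiantsHypothesis.ValiantsHypothesis.Theorems.SymPencilPerFourOneRowKernel
import Mathlib.Algebra.Module.Projective
import Mathlib.LinearAlgebra.Matrix.BilinearForm

/-!
# Route `SymPencil` — the one-row kernel cell at DEFECT TWO: from the base-point package to the
# abstract flow identities (`--supports` stmt-ValiantsHypothesis-5674; rung currency for
# `sdc(per_4)`, size-`27` cell `(12,4,2)`; nothing here bears on `VP ≠ VNP`)

Setting: the base-point package of a symmetric affine determinantal representation of `per_4`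
(`SymPencilPerFourBasePointPackage`): `D` invertible symmetric on `ι'`, kernel rows `bL`, symmetric
blocks `CL`, `κ ≠ 0`, the third origin moment `hiii`, and the base-point pencil identity `hN`; ONE-ROW
data `embV`, `embX` as in `SymPencilPerFourOneRowKernel` (`bL ∘ embV = 0`, `bL ∘ embX` onto
`B := im bL`, `per_4 (embV w + s · embX x) = s³ per [w; x]`), affineness of `per_4` along `embV w`,
and the DEFECT-TWO count `|ι'| ≤ 2 dim B + 2` (size `27`: `|ι'| = 26`, `dim B = 12`).  What is NOT
assumed is the kernel invariance `CL(v) D⁻¹ B ⊆ B` of `SymPencilPerFourOneRowCells` (it fails at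
defect `2`).

* `exists_invariant_extension`: along an affine kernel direction `v`, with `S = CL(v) D⁻¹`, cyclic
  isotropy (`SymPencilCyclicIsotropy`) makes `B + S B + S² B` totally `D⁻¹`-isotropic, hence of
  dimension `≤ dim B + 1`; so `U' := B + K t₁` (`t₁ = S b₁` for a suitable kernel row `b₁`, possibly
  `t₁ ∈ B`) satisfies `S U' ⊆ U'`.
* `exists_flow_identities`: fix a base row `w` along which the base-point determinant is constant
  (`det (D + t CL(embV w)) = det D`; automatic over an algebraically closed field,
  `SymPencilBasePointDetConst`).  Parametrising `U'` by `U := K^{3×4} × K` through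
  `φ (x, a) = bL (embX x) + a t₁` and lifting `S` to `M : U → U` (`φ ∘ M = S ∘ φ`), the master identity
  `SymPencilAffineKernelLever.master_of_affine` at the base points `t · embV w` and the second
  difference of `hiii` along `embV w ± embX x` become the two ABSTRACT identities
    (flow)  `u + t M u = (x, 0)  ⟹  det D · Γ_x(u, u) = κ t · per [w; x]`,
    (E1)    `2 det D · Γ_x(M (x,0), (x,0)) = - κ · per [w; x]`,
  with `Γ_x(u, u') = (D⁻¹ φ u)ᵀ CL(embX x) (D⁻¹ φ u')` (linear in `x`, bilinear in `u, u'`).  These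
  are the inputs of the defect-two endgame.  When the invariance holds (`t₁ ∈ B`) they contain the
  identities (K0)/(K1) of `SymPencilPerFourOneRowKernel`.
Elementary; no definitions, no named facts. [folklore]
-/

noncomputable section

-- single-conjunct layout: Sub = Summit, duplicated namespace component intended
set_option linter.dupNamespace false

namespace Summit.ValiantsHypothesis.ValiantsHypothesis.Theorems.SymPencilPerFourOneRowDefectTwoKernel

open Matrix Module MvPolynomial
open Literature.Computability.AlgebraicComplexity
open Summit.ValiantsHypothesis.ValiantsHypothesis.Theorems.SymPencilLagrangianKernel
open Summit.ValiantsHypothesis.ValiantsHypothesis.Theorems.SymPencilHomogeneousDropRankCodim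
open Summit.ValiantsHypothesis.ValiantsHypothesis.Theorems.SymPencilCyclicIsotropy
open Summit.ValiantsHypothesis.ValiantsHypothesis.Theorems.SymPencilAffineKernelLever
open Summit.ValiantsHypothesis.ValiantsHypothesis.Theorems.SymPencilPerFourOneRowKernel
open Summit.ValiantsHypothesis.ValiantsHypothesis.Theorems.SymPencilPerFourInnerRankRows

universe u

variable {k : Type u} [Field k] [CharZero k] {ι' : Type*} [Fintype ι'] [DecidableEq ι']

/-- **The invariant extension of the kernel rows along an affine kernel direction.**  If
`|ι'| ≤ 2 dim (im bL) + 2`, `bL v = 0` and `per_4` is affine along `v`, then for `S = CL(v) D⁻¹`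
there is a kernel row `b₁ = bL y₁` such that `S (im bL + K S b₁) ⊆ im bL + K S b₁`. [folklore] -/
theorem exists_invariant_extension {D : Matrix ι' ι' k} (hD : IsUnit D.det) (hDs : Dᵀ = D)
    (bL : (Fin 4 × Fin 4 → k) →ₗ[k] (ι' → k)) (CL : (Fin 4 × Fin 4 → k) →ₗ[k] Matrix ι' ι' k)
    (hCs : ∀ z, (CL z)ᵀ = CL z) {κ : k} (hκ : κ ≠ 0)
    (hN : ∀ v, bL v = 0 → IsUnit (D + CL v).det ∧ ∀ (z : Fin 4 × Fin 4 → k) (s : k),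
      κ * MvPolynomial.eval (v + s • z) (perPoly (Fin 4) k) =
        (Matrix.fromBlocks ((s * 0) • (1 : Matrix Unit Unit k))
          (Matrix.replicateRow Unit (s • bL z)) (Matrix.replicateCol Unit (s • bL z))
          (D + CL v + s • CL z)).det)
    (hdef : Fintype.card ι' ≤ 2 * finrank k (LinearMap.range bL) + 2)
    (v : Fin 4 × Fin 4 → k) (hv : bL v = 0)
    (haff : ∀ z, ∃ e₀ e₁ : k, ∀ s : k,
      MvPolynomial.eval (z + s • v) (perPoly (Fin 4) k) = e₀ + s * e₁) :
    ∃ y₁ : Fin 4 × Fin 4 → k, ∀ u ∈ LinearMap.range bL ⊔ k ∙ (CL v *ᵥ (D⁻¹ *ᵥ bL y₁)),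
      CL v *ᵥ (D⁻¹ *ᵥ u) ∈ LinearMap.range bL ⊔ k ∙ (CL v *ᵥ (D⁻¹ *ᵥ bL y₁)) := by
  classical
  have hDis : (D⁻¹)ᵀ = D⁻¹ := by rw [Matrix.transpose_nonsing_inv, hDs]
  have hDiu : IsUnit D⁻¹ :=
    (Matrix.isUnit_iff_isUnit_det _).2 (Matrix.isUnit_nonsing_inv_det_iff.2 hD)
  set B := LinearMap.range bL with hB
  set Sl : (ι' → k) →ₗ[k] (ι' → k) := (CL v * D⁻¹).mulVecLin with hSl
  have hS : ∀ y, Sl y = CL v *ᵥ (D⁻¹ *ᵥ y) := fun y => by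
    rw [hSl, Matrix.mulVecLin_apply, Matrix.mulVec_mulVec]
  -- `S` is self-adjoint for `D⁻¹`
  have hadj : ∀ p q : ι' → k, Sl p ⬝ᵥ D⁻¹ *ᵥ q = p ⬝ᵥ D⁻¹ *ᵥ Sl q := by
    intro p q
    rw [hS, hS, ← dotProduct_mulVec_of_transpose_eq (hCs v),
      ← dotProduct_mulVec_of_transpose_eq hDis]
  -- `D⁻¹ S^n = (D⁻¹ CL v)^n D⁻¹`
  have hT : ∀ (n : ℕ) (q : ι' → k), D⁻¹ *ᵥ (Sl ^ n) q = ((D⁻¹ * CL v) ^ n * D⁻¹) *ᵥ q := by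
    intro n
    induction n with
    | zero => intro q; rw [pow_zero, pow_zero, Module.End.one_apply, Matrix.one_mul]
    | succ n ih =>
      intro q
      rw [pow_succ', Module.End.mul_apply, hS, Matrix.mulVec_mulVec, ih, Matrix.mulVec_mulVec,
        pow_succ']
      simp only [Matrix.mul_assoc]
  -- cyclic isotropy: `⟨S^i b, S^j b'⟩ = 0`
  have hc := fun (z z' : Fin 4 × Fin 4 → k) (n : ℕ) =>
    cyclic_isotropy_of_affine hD hDs bL CL hCs hκ hN v hv haff z z' n
  have hpair : ∀ (i j : ℕ) (z z' : Fin 4 × Fin 4 → k),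
      (Sl ^ i) (bL z) ⬝ᵥ D⁻¹ *ᵥ (Sl ^ j) (bL z') = 0 := by
    intro i
    induction i with
    | zero =>
      intro j z z'
      rw [pow_zero, Module.End.one_apply, hT]
      exact hc z z' j
    | succ i ih =>
      intro j z z'
      rw [pow_succ', Module.End.mul_apply, hadj, ← Module.End.mul_apply, ← pow_succ']
      exact ih (j + 1) z z'
  -- the isotropic space `W = B + S B + S² B` has dimension `≤ dim B + 1`
  set W : Submodule k (ι' → k) := B ⊔ B.map Sl ⊔ B.map (Sl ^ 2) with hW
  have hWiso : ∀ x ∈ W, x ⬝ᵥ D⁻¹ *ᵥ x = 0 := by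
    intro x hx
    rw [hW, Submodule.mem_sup] at hx
    obtain ⟨x', hx', _, ⟨_, ⟨z₂, rfl⟩, rfl⟩, rfl⟩ := hx
    rw [Submodule.mem_sup] at hx'
    obtain ⟨_, ⟨z₀, rfl⟩, _, ⟨_, ⟨z₁, rfl⟩, rfl⟩, rfl⟩ := hx'
    have e := fun (i j : ℕ) => hpair i j
    have h0 : bL z₀ = (Sl ^ 0) (bL z₀) := by rw [pow_zero, Module.End.one_apply]
    have h1 : Sl (bL z₁) = (Sl ^ 1) (bL z₁) := by rw [pow_one]
    rw [h0, h1]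
    simp only [Matrix.mulVec_add, dotProduct_add, add_dotProduct, e, add_zero]
  have hWdim : finrank k W ≤ finrank k B + 1 := by
    have h := rank_add_two_mul_finrank_le_of_quadratic_form_eq_zero hDis W hWiso
    rw [Matrix.rank_of_isUnit _ hDiu] at h
    omega
  -- the two cases
  by_cases hinv : ∀ z, Sl (bL z) ∈ B
  · refine ⟨0, fun u hu => ?_⟩
    rw [map_zero, Matrix.mulVec_zero, Matrix.mulVec_zero, Submodule.span_zero_singleton,
      sup_bot_eq] at hu ⊢
    obtain ⟨z, rfl⟩ := hu
    rw [← hS]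
    exact hinv z
  · push Not at hinv
    obtain ⟨y₁, hy₁⟩ := hinv
    refine ⟨y₁, fun u hu => ?_⟩
    rw [← hS] at hu ⊢
    set U' : Submodule k (ι' → k) := B ⊔ k ∙ Sl (bL y₁) with hU'
    -- `U' = W` by dimension
    have hU'W : U' ≤ W := by
      rw [hU', hW]
      refine sup_le (le_sup_left.trans le_sup_left) ?_
      rw [Submodule.span_singleton_le_iff_mem]
      exact Submodule.mem_sup_left (Submodule.mem_sup_right ⟨bL y₁, ⟨y₁, rfl⟩, rfl⟩)
    have hBlt : B < U' := by
      refine lt_of_le_of_ne le_sup_left fun h => hy₁ ?_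
      rw [h, hU']
      exact Submodule.mem_sup_right (Submodule.mem_span_singleton_self _)
    have hlt := Submodule.finrank_lt_finrank_of_lt hBlt
    have hUeq : U' = W :=
      Submodule.eq_of_le_of_finrank_le hU'W (by omega)
    -- `S U' ⊆ S B + S² B ⊆ W = U'`
    rw [hU', Submodule.mem_sup] at hu
    obtain ⟨_, ⟨z, rfl⟩, t, ht, rfl⟩ := hu
    obtain ⟨a, rfl⟩ := Submodule.mem_span_singleton.1 ht
    rw [← hS, hUeq, hW, map_add, map_smul]
    refine Submodule.add_mem _
      (Submodule.mem_sup_left (Submodule.mem_sup_right ⟨bL z, ⟨z, rfl⟩, rfl⟩))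
      (Submodule.smul_mem _ a (Submodule.mem_sup_right ⟨bL y₁, ⟨y₁, rfl⟩, ?_⟩))
    rw [pow_two, Module.End.mul_apply]

/-- **The defect-two one-row cell, reduced to abstract flow identities.**  See the module
docstring. [folklore] -/
theorem exists_flow_identities {D : Matrix ι' ι' k} (hD : IsUnit D.det) (hDs : Dᵀ = D)
    (bL : (Fin 4 × Fin 4 → k) →ₗ[k] (ι' → k))
    (CL : (Fin 4 × Fin 4 → k) →ₗ[k] Matrix ι' ι' k) (hCs : ∀ z, (CL z)ᵀ = CL z)
    {κ : k} (hκ : κ ≠ 0)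
    (hiii : ∀ z, D.det * (bL z ⬝ᵥ (D⁻¹ * CL z * D⁻¹ * CL z * D⁻¹) *ᵥ bL z) =
      -(κ * MvPolynomial.eval z (perPoly (Fin 4) k)))
    (hN : ∀ v, bL v = 0 → IsUnit (D + CL v).det ∧ ∀ (z : Fin 4 × Fin 4 → k) (s : k),
      κ * MvPolynomial.eval (v + s • z) (perPoly (Fin 4) k) =
        (Matrix.fromBlocks ((s * 0) • (1 : Matrix Unit Unit k))
          (Matrix.replicateRow Unit (s • bL z)) (Matrix.replicateCol Unit (s • bL z))
          (D + CL v + s • CL z)).det)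
    (hdef : Fintype.card ι' ≤ 2 * finrank k (LinearMap.range bL) + 2)
    (embV : (Fin 4 → k) →ₗ[k] (Fin 4 × Fin 4 → k))
    (embX : (Fin 3 → Fin 4 → k) →ₗ[k] (Fin 4 × Fin 4 → k))
    (hEV : ∀ w, bL (embV w) = 0) (hEXr : ∀ z, ∃ x, bL (embX x) = bL z)
    (hper : ∀ (w : Fin 4 → k) (x : Fin 3 → Fin 4 → k) (s : k),
      MvPolynomial.eval (embV w + s • embX x) (perPoly (Fin 4) k) =
        s ^ 3 * (Matrix.of ![w, x 0, x 1, x 2]).permanent)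
    (w : Fin 4 → k)
    (haff : ∀ z, ∃ e₀ e₁ : k, ∀ s : k,
      MvPolynomial.eval (z + s • embV w) (perPoly (Fin 4) k) = e₀ + s * e₁)
    (hdet : ∀ t : k, (D + t • CL (embV w)).det = D.det) :
    ∃ (Γ : (Fin 3 → Fin 4 → k) →ₗ[k]
        ((Fin 3 → Fin 4 → k) × k) →ₗ[k] ((Fin 3 → Fin 4 → k) × k) →ₗ[k] k)
      (M : ((Fin 3 → Fin 4 → k) × k) →ₗ[k] ((Fin 3 → Fin 4 → k) × k)),
      (∀ (x : Fin 3 → Fin 4 → k) (t : k) (u : (Fin 3 → Fin 4 → k) × k),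
        u + t • M u = (x, 0) →
          D.det * Γ x u u = κ * t * (Matrix.of ![w, x 0, x 1, x 2]).permanent) ∧
      ∀ x : Fin 3 → Fin 4 → k,
        2 * D.det * Γ x (M (x, 0)) (x, 0) = -(κ * (Matrix.of ![w, x 0, x 1, x 2]).permanent) := by
  classical
  have hDis : (D⁻¹)ᵀ = D⁻¹ := by rw [Matrix.transpose_nonsing_inv, hDs]
  set v := embV w with hvdef
  have hv : bL v = 0 := hEV w
  set B := LinearMap.range bL with hB
  set Sl : (ι' → k) →ₗ[k] (ι' → k) := (CL v * D⁻¹).mulVecLin with hSl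
  have hS : ∀ y, Sl y = CL v *ᵥ (D⁻¹ *ᵥ y) := fun y => by
    rw [hSl, Matrix.mulVecLin_apply, Matrix.mulVec_mulVec]
  -- the invariant extension `U' = B + K t₁`
  obtain ⟨y₁, hU'⟩ := exists_invariant_extension hD hDs bL CL hCs hκ hN hdef v hv haff
  set t₁ : ι' → k := CL v *ᵥ (D⁻¹ *ᵥ bL y₁) with ht₁
  -- the parametrisation `φ (x, a) = bL (embX x) + a t₁`
  set φ : ((Fin 3 → Fin 4 → k) × k) →ₗ[k] (ι' → k) :=
    (bL ∘ₗ embX).coprod (LinearMap.toSpanSingleton k (ι' → k) t₁) with hφdef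
  have hφ : ∀ x a, φ (x, a) = bL (embX x) + a • t₁ := fun x a => by
    rw [hφdef, LinearMap.coprod_apply, LinearMap.comp_apply, LinearMap.toSpanSingleton_apply]
  have hφ0 : ∀ x, φ (x, 0) = bL (embX x) := fun x => by rw [hφ, zero_smul, add_zero]
  have hrange : LinearMap.range φ = B ⊔ k ∙ t₁ := by
    rw [hφdef, LinearMap.range_coprod, ← LinearMap.span_singleton_eq_range]
    congr 1
    refine le_antisymm ?_ ?_
    · rintro _ ⟨x, rfl⟩; exact ⟨embX x, rfl⟩
    · rintro _ ⟨z, rfl⟩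
      obtain ⟨x, hx⟩ := hEXr z
      exact ⟨x, by rw [LinearMap.comp_apply, hx]⟩
  have hSφ : ∀ y ∈ LinearMap.range φ, Sl y ∈ LinearMap.range φ := by
    intro y hy
    rw [hrange] at hy ⊢
    rw [hS]
    exact hU' y hy
  -- the lift `M` of `S` through `φ`
  obtain ⟨σ, hσ⟩ := LinearMap.exists_rightInverse_of_surjective φ.rangeRestrict
    (LinearMap.range_rangeRestrict φ)
  set Sr : LinearMap.range φ →ₗ[k] LinearMap.range φ :=
    (Sl.domRestrict (LinearMap.range φ)).codRestrict (LinearMap.range φ)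
      (fun y => hSφ y.1 y.2) with hSr
  set M : ((Fin 3 → Fin 4 → k) × k) →ₗ[k] ((Fin 3 → Fin 4 → k) × k) :=
    σ ∘ₗ Sr ∘ₗ φ.rangeRestrict with hMdef
  have hMφ : ∀ u, φ (M u) = Sl (φ u) := by
    intro u
    have h1 : ∀ s : LinearMap.range φ, φ (σ s) = (s : ι' → k) := fun s => by
      have h := congr_arg
        (fun f : LinearMap.range φ →ₗ[k] LinearMap.range φ => ((f s : _) : ι' → k)) hσ
      simpa only [LinearMap.comp_apply, LinearMap.id_apply, LinearMap.codRestrict_apply] using h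
    rw [hMdef, LinearMap.comp_apply, LinearMap.comp_apply, h1, hSr, LinearMap.codRestrict_apply,
      LinearMap.domRestrict_apply]
    rfl
  -- the forms `Γ_x`
  set ψ : ((Fin 3 → Fin 4 → k) × k) →ₗ[k] (ι' → k) := D⁻¹.mulVecLin ∘ₗ φ with hψdef
  have hψ : ∀ u, ψ u = D⁻¹ *ᵥ φ u := fun u => rfl
  let Γ : (Fin 3 → Fin 4 → k) →ₗ[k]
      ((Fin 3 → Fin 4 → k) × k) →ₗ[k] ((Fin 3 → Fin 4 → k) × k) →ₗ[k] k :=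
    { toFun := fun x => (Matrix.toBilin' (CL (embX x))).compl₁₂ ψ ψ
      map_add' := fun x y => by
        refine LinearMap.ext fun u => LinearMap.ext fun u' => ?_
        simp only [map_add, LinearMap.compl₁₂_apply, LinearMap.add_apply, Matrix.toBilin'_apply']
      map_smul' := fun c x => by
        refine LinearMap.ext fun u => LinearMap.ext fun u' => ?_
        simp only [map_smul, LinearMap.compl₁₂_apply, LinearMap.smul_apply, Matrix.toBilin'_apply',
          RingHom.id_apply] }
  have hΓ : ∀ x u u', Γ x u u' = (D⁻¹ *ᵥ φ u) ⬝ᵥ CL (embX x) *ᵥ (D⁻¹ *ᵥ φ u') := fun x u u' => by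
    show (Matrix.toBilin' (CL (embX x))).compl₁₂ ψ ψ u u' = _
    rw [LinearMap.compl₁₂_apply, Matrix.toBilin'_apply', hψ, hψ]
  -- permanents along the base row
  have hper1 : ∀ (x : Fin 3 → Fin 4 → k) (t : k),
      MvPolynomial.eval (embX x + t • v) (perPoly (Fin 4) k) =
        t * (Matrix.of ![w, x 0, x 1, x 2]).permanent := by
    intro x t
    have h := hper (t • w) x 1
    rw [one_smul, one_pow, one_mul, permanent_rows_smul₀, map_smul] at h
    rw [add_comm, hvdef, h]
  have hper0 : ∀ x : Fin 3 → Fin 4 → k, MvPolynomial.eval (embX x) (perPoly (Fin 4) k) = 0 := by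
    intro x
    have h := hper 0 x 1
    rwa [map_zero, zero_add, one_smul, one_pow, one_mul, per_zero_row₀] at h
  refine ⟨Γ, M, fun x t u hu => ?_, fun x => ?_⟩
  · -- the flow identity from the master identity at the base point `t v`
    have htv : bL (t • v) = 0 := by rw [map_smul, hv, smul_zero]
    have hafft : ∀ z, ∃ e₀ e₁ : k, ∀ s : k,
        MvPolynomial.eval (z + s • (t • v)) (perPoly (Fin 4) k) = e₀ + s * e₁ := by
      intro z
      obtain ⟨e₀, e₁, he⟩ := haff z
      exact ⟨e₀, t * e₁, fun s => by rw [smul_smul, he]; ring⟩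
    have hm := master_of_affine hDs bL CL hCs hκ hN (t • v) htv hafft (embX x)
    have hCt : CL (t • v) = t • CL v := map_smul _ _ _
    have hNu : IsUnit (D + t • CL v).det := by rw [← hCt]; exact (hN (t • v) htv).1
    -- `(D + t CL v) (D⁻¹ φ u) = φ u + t S (φ u) = bL (embX x)`
    have hφu : φ u + t • Sl (φ u) = bL (embX x) := by
      have h := congr_arg φ hu
      rwa [map_add, map_smul, hMφ, hφ0] at h
    have hsol : (D + t • CL v)⁻¹ *ᵥ bL (embX x) = D⁻¹ *ᵥ φ u := by
      have h2 : (D + t • CL v) *ᵥ (D⁻¹ *ᵥ φ u) = bL (embX x) := by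
        rw [Matrix.add_mulVec, Matrix.mulVec_mulVec, Matrix.mul_nonsing_inv _ hD,
          Matrix.one_mulVec, Matrix.smul_mulVec, Matrix.mulVec_mulVec, ← hφu,
          ← Matrix.mulVec_mulVec, ← hS]
      rw [← h2, Matrix.mulVec_mulVec, Matrix.nonsing_inv_mul _ hNu, Matrix.one_mulVec]
    rw [hCt, hdet t, hsol, hper1, hper0, sub_zero] at hm
    rw [hΓ, hm]
    ring
  · -- (E1) from the second difference of `hiii` along `v ± embX x`
    set b := bL (embX x) with hbdef
    set Cx := CL (embX x) with hCx
    have hzp : MvPolynomial.eval (v + embX x) (perPoly (Fin 4) k) =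
        (Matrix.of ![w, x 0, x 1, x 2]).permanent := by
      have h := hper w x 1
      rwa [one_smul, one_pow, one_mul] at h
    have hzm : MvPolynomial.eval (v + (-1 : k) • embX x) (perPoly (Fin 4) k) =
        -(Matrix.of ![w, x 0, x 1, x 2]).permanent := by
      have h := hper w x (-1)
      rw [h]; ring
    have h1 := hiii (v + embX x)
    have h2 := hiii (v + (-1 : k) • embX x)
    rw [map_add, hv, zero_add, map_add, hzp] at h1
    rw [map_add, map_smul, hv, zero_add, map_add, map_smul, hzm, neg_one_smul,
      Matrix.mulVec_neg, dotProduct_neg, neg_dotProduct, neg_neg, neg_one_smul,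
      ← sub_eq_add_neg] at h2
    have key : D⁻¹ * (CL v + Cx) * D⁻¹ * (CL v + Cx) * D⁻¹ -
        D⁻¹ * (CL v - Cx) * D⁻¹ * (CL v - Cx) * D⁻¹ =
        (D⁻¹ * CL v * D⁻¹ * Cx * D⁻¹ + D⁻¹ * Cx * D⁻¹ * CL v * D⁻¹) +
        (D⁻¹ * CL v * D⁻¹ * Cx * D⁻¹ + D⁻¹ * Cx * D⁻¹ * CL v * D⁻¹) := by
      noncomm_ring
    -- the two mixed sandwiches agree (transpose symmetry)
    have hsym : b ⬝ᵥ (D⁻¹ * Cx * D⁻¹ * CL v * D⁻¹) *ᵥ b =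
        b ⬝ᵥ (D⁻¹ * CL v * D⁻¹ * Cx * D⁻¹) *ᵥ b := by
      have hT : (D⁻¹ * CL v * D⁻¹ * Cx * D⁻¹)ᵀ = D⁻¹ * Cx * D⁻¹ * CL v * D⁻¹ := by
        rw [Matrix.transpose_mul, Matrix.transpose_mul, Matrix.transpose_mul,
          Matrix.transpose_mul, hDis, hCs, hCx, hCs]
        simp only [Matrix.mul_assoc]
      rw [← hT, Matrix.dotProduct_mulVec, Matrix.vecMul_transpose, dotProduct_comm]
    have hdiff : b ⬝ᵥ (D⁻¹ * (CL v + Cx) * D⁻¹ * (CL v + Cx) * D⁻¹) *ᵥ b -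
        b ⬝ᵥ (D⁻¹ * (CL v - Cx) * D⁻¹ * (CL v - Cx) * D⁻¹) *ᵥ b =
        4 * (b ⬝ᵥ (D⁻¹ * CL v * D⁻¹ * Cx * D⁻¹) *ᵥ b) := by
      have h := congr_arg (fun N : Matrix ι' ι' k => b ⬝ᵥ N *ᵥ b) key
      simp only [Matrix.sub_mulVec, Matrix.add_mulVec, dotProduct_sub, dotProduct_add] at h
      rw [hsym] at h
      linear_combination h
    have hmix : b ⬝ᵥ (D⁻¹ * CL v * D⁻¹ * Cx * D⁻¹) *ᵥ b =
        (D⁻¹ *ᵥ (CL v *ᵥ (D⁻¹ *ᵥ b))) ⬝ᵥ Cx *ᵥ (D⁻¹ *ᵥ b) := by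
      simp only [← Matrix.mulVec_mulVec]
      rw [dotProduct_mulVec_of_transpose_eq hDis, dotProduct_mulVec_of_transpose_eq (hCs v),
        dotProduct_mulVec_of_transpose_eq hDis]
    have hE : 2 * (D.det * (b ⬝ᵥ (D⁻¹ * CL v * D⁻¹ * Cx * D⁻¹) *ᵥ b)) =
        -(κ * (Matrix.of ![w, x 0, x 1, x 2]).permanent) := by
      have h3 : D.det * (4 * (b ⬝ᵥ (D⁻¹ * CL v * D⁻¹ * Cx * D⁻¹) *ᵥ b)) =
          -(κ * (Matrix.of ![w, x 0, x 1, x 2]).permanent) -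
            -(κ * -(Matrix.of ![w, x 0, x 1, x 2]).permanent) := by
        rw [← hdiff, mul_sub, h1, h2]
      linear_combination h3 / 2
    rw [hΓ, hMφ, hφ0, hS, ← hmix, ← hE]
    ring

end Summit.ValiantsHypothesis.ValiantsHypothesis.Theorems.SymPencilPerFourOneRowDefectTwoKernel

end
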